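import Summits.HodgeConjecture.HodgeConjecture.Cruxes.BlochSeedDiscOne.SeedCheckerFrame
import Summits.HodgeConjecture.HodgeConjecture.Cruxes.BlochSeedDiscOne.SeedCheckerWords
import Summits.HodgeConjecture.HodgeConjecture.Cruxes.BlochSeedDiscOne.SeedCheckerNewtonClosure
import Summits.HodgeConjecture.HodgeConjecture.Cruxes.BlochSeedDiscOne.SeedCheckerDegree
import Literature.AlgebraicTopology.SingularHomology.CupProductProofs
import Literature.AlgebraicTopology.SingularHomology.CupProductExteriorH1
import Literature.AlgebraicGeometry.HodgeTheory.CorrespondenceCupProductIdentities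
import Literature.AlgebraicGeometry.HodgeTheory.ComplexGysinHodgeType
import Literature.AlgebraicGeometry.HodgeTheory.BlochSemiregularSpreadFromSubscheme

/-!
# Seed checker C5–C8 · v40 `SeedCheckerGramValue` — the VALUE of the Gram constant of the frame of record:
# `eeee ∪ ēēēē = 256·q⁸·p^{⊠4}`, `h_std⁸ = 8!·p^{⊠4}`, hence `γ(v, h_std) = 512·q⁸`, `γ(v, h_K) = 2·(q∕t)⁸`; MEMO-06's `γ = 2 ⟺ |q| = t`

Unit `hsemireg-c5c8-1`, gen 40 (planner, explicit unit MINT A5 «C5–C8 seed checker»; claim-free, kit 0; words by director-hodge only —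
none naming c5c8 after R19.755). Token: line stmt-HodgeConjecture-18881 Cruxes/BlochSeedDiscOne/Lines/birth.lean 814a6a70c14e831a
stub_rung_pad4_seedAt.

HONEST FRAMING. A TYPED, KERNEL-CHECKED FILE — NOT A RUNG. Nothing here is proved toward HC ∕ HC_CM ∕ HC_AV ∕ №4 ∕ 26512 ∕ 18881 ∕ H2;
`stub_rung_pad4_seedAt` is never restated, weakened or used. No candidate (design json, presentation) exists, so nothing is run on one.
Additive: no earlier seed-checker module is edited; imports only BUILT modules (v7.1 `SeedCheckerFrame`, v10 `SeedCheckerWords`, v23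
`SeedCheckerNewtonClosure`, v12 `SeedCheckerDegree`) and Literature — v38 `SeedCheckerNewtonKit` and v39 `SeedCheckerKunnethSquare` are NOT yet
built on the farm snapshot (`lean check` rc 75 `unbuilt`), so the few v39 lemmas needed (interchange, `cross_cup_cross`, the tower squares, the
`FrameGram`-of-record iff) are RE-DERIVED here (§40.1, §40.4, §40.6; the generic ones `private`); no `instance`, no `notation`, no unsafe option,
0 `sorry`; main theorems depend on `[propext, Classical.choice, Quot.sound]` only.

WHAT IT CLOSES. g39 §4 LEFTOVERS (i)–(ii): v39 reduced v23's kit hypothesis `FrameGram K.F h γ` on the frame of record to ONE number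
`γ(v, h) = 2·8!·deg_h(ω(v))`, «NOT shown rational here» and `v`-relative by an unnamed real `r⁸`. Here that number is COMPUTED:

* §40.2 on the curve: `H²(E₀(ℂ))` is a line (`exists_eq_smul_eta`), so `v ∪ ψ₀^*v = q·η` with **`q = q(v) ∈ ℚ`** for rational `v`, `η`
  (`exists_rat_cup_map_eq_smul`: `IsRationalClass.cup ∕ .map ∕ exists_rat_eq_of_smul`) and **`q ≠ 0`** (`cup_map_one_ne_zero`,
  `rat_ne_zero_of_cup_map_eq`: perfect cup pairing of the closed surface `E₀(ℂ)`); `x⁺ ∪ x⁻ = 2iq·η`, `x⁻ ∪ x⁺ = −2iq·η`, `x^± ∪ x^± = 0`;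
  **`q(a·v + b·ψ₀^*v) = (a² + b²)·q(v)`** (`cup_map_of_rat_comb`) and every rational `v'` IS such a combination with `a, b ∈ ℚ` (`exists_rat_pair_eq`:
  `{v, ψ₀^*v}` is a `ℚ`-basis of the rational `H¹`, `linearIndependent_iff_of_isRationalClass`) — so `|q|` is an anchor invariant up to NORMS of `ℚ(i)^×`.
* §40.3 on `S = E₀²`: `e ∪ e = ē ∪ ē = 0`, **`e ∪ ē = ē ∪ e = −4q²·p`**, `p = pr₁^*η ∪ pr₂^*η` v10's point word (`pLetter`), `p ≠ 0`.
* §40.4 up the nested tower: `pstep b x = pr₁^*b ∪ pr₂^*x` for a surface class of degree `4`, `ppppOf x = x ⊠ x ⊠ x ⊠ x ∈ H¹⁶(S⁴(ℂ))`,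
  `eeee ∪ ēēēē = (e ∪ ē)^{⊠4}` (three Künneth squares, `eeee_cup_eeeeBar_eq_ppppOf`), hence **`eeee ∪ ēēēē = 256·q⁸ · p^{⊠4}`**
  (`eeee_cup_eeeeBar_eq`); `eeee² = ēēēē² = 0`, `ēēēē ∪ eeee = eeee ∪ ēēēē`; `x^{⊠4} ≠ 0` for `x ≠ 0`.
* §40.5 the frame polarisation: `pppp` is THE e-free word of degree `8` (`eq_ppppWord_of_wdeg_eq`), `cls(pppp)_8 = p^{⊠4}` (`frameCls4_ppppWord`),
  so v10's law (F1) `Σ_{w e-free} cls(w)_8 = h_std^[8]` (`frameCls4_law`) reads **`h_std⁸ = 8!·p^{⊠4} = 40320·p^{⊠4}`** (`cupPowTwo_hStd_eight`)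
  and **`h_std⁸ ≠ 0`** PURELY TOPOLOGICALLY (`cupPowTwo_hStd_eight_ne_zero`; v8 ∕ v12 took it from ampleness).
* §40.6 THE GRAM CONSTANT: `2·8!·(eeee ∪ ēēēē) = 512·q⁸ · h_std⁸` (`smul_eeee_cup_eeeeBar_eq_smul_hStd_pow`); v23's `FrameGram` of record is the one
  identity `80640·(eeee ∪ ēēēē) = γ·h⁸` (`frameGram_iff_top_identity`, = v39); hence
  **`frameGram_normalisedFrame_hStd_iff : FrameGram (normalisedFrame …) h_std γ ↔ γ = 512·q⁸`** — RATIONAL, POSITIVE (`frameGram_value_pos`),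
  `2` iff `|q| = 1∕2` (`frameGram_normalisedFrame_hStd_two_iff`); under rescaling `FrameGram F (c·h) γ ↔ FrameGram F h (γ·c⁸)` (`frameGram_smul_iff`),
  so against the KIT polarisation `h_K = symH = 2t·h_std` (v4 `AnchorKit.symH_eq`):
  **`frameGram_normalisedFrame_symH_iff : FrameGram (normalisedFrame …) h_K γ ↔ γ = 2·(q∕t)⁸`** and
  **`frameGram_normalisedFrame_symH_two_iff : FrameGram (normalisedFrame …) h_K 2 ↔ |q| = t`**; explicitly `v`-relative:
  `γ(a·v + b·ψ₀^*v, h_std) = (a² + b²)⁸·γ(v, h_std)` (`frameGram_normalisedFrame_hStd_rat_comb`; v39's `r = a² + b²`); and ATTAINABILITY: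
  **`exists_frameGram_symH_two_iff`: some rational `v' ≠ 0` has `γ_K(v') = 2` iff `∃ a b : ℚ, (a² + b²)·|q(v)| = t`** — iff `t ∕ |q|` is a norm from `ℚ(i)^×`.

FLAG DELTA (g39 §3, row «`FrameGram` for the frame of record = one number `γ(v, h)`, not shown rational, `v`-relative by `r⁸`»; nothing in
C5–C8 becomes vacuous or implied by C0–C4): NOW `γ(v, h_std) = 512·q(v)⁸` and `γ(v, h_K) = 2·(q(v)∕t)⁸` are EXPLICIT POSITIVE RATIONALS computed
from TWO rationals of the kit (`q(v)`, the `η`-coordinate of `v ∪ ψ₀^*v`; `t`, the polarisation scale `e^*a = t·h_std`); the `v`-relativity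
factor is `(a² + b²)⁸`, a NORM⁸ from `ℚ(i)`. Consequently MEMO-06's «`∫ w_μ² = 2|μ|²`» (`γ = 2` for `h_K`) is DECIDABLE on the kit — it is
the normalisation `|q(v)| = t` — and is NOT always attainable by re-choosing `v`: it needs `t ∕ |q(v₀)|` to be a sum of two rational squares
(false e.g. for `3`). A candidate naming `μ` in the frame of record (C0 `mu`) with v23's (R4) numeric door `P₈ + 18·γ·N(μ) = 0` must therefore
carry `(q(v), t)` (or `v` itself); with them `γ` is no longer a free real but `2·(q∕t)⁸`, and (R4) becomes `P₈ + 36·(q∕t)⁸·N(μ) = 0` over `ℚ`.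

Sources: Hatcher, Algebraic Topology (2002) §3.2 Prop. 3.10, Thm. 3.11, Künneth Thm. 3.15 online ed. (3.16 in print), §3.3 Prop. 3.38
[cite: HatcherAT2002, §3.2 Thm. 3.16]; van Geemen 1994 (Weil classes, the `e ∕ ē` letters) [cite: vanGeemen1994HodgeAV, 4.9–4.11 and proof of
Thm. 6.12]; Birkenhake–Lange (Betti numbers of complex tori) [cite: LangeBirkenhake1992, §1.1]; Voisin, Hodge Theory I §7.1.1 (rational
structure) [cite: VoisinHodgeI2002, §7.1.1]; tree: v4 `SeedChecker` (`hStd`, `AnchorKit`, `symH_eq`), v7.1 `SeedCheckerFrame` (`xPlus`, `eLetter`,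
`cross`, `eeee`, `normalisedFrame_wOf`), v10 `SeedCheckerWords` (`pLetter`, `frameCls4_law`, `famCross_single`), v23 `SeedCheckerNewtonClosure`
(`FrameGram`), `CupProductProofs` (`cupProduct_gradedComm_holds`, `cupProduct_assoc`), `CupProductExteriorH1` (`cup_self_deg_one`),
`ComplexGysinHodgeType` (`eq_zero_of_forall_cupPairing_eq_zero`), `WeilClassesProductsOfFactors` (`cupProduct_map_fst_map_snd_ne_zero_of_add_eq`),
`WeilSurfaceCMSquare` (`linearIndependent_pair_map_one`), `RationalClassesIndependent` (`linearIndependent_iff_of_isRationalClass`),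
`BlochSemiregularSpreadFromSubscheme` (`IsRationalClass.exists_rat_eq_of_smul`), `AbelianVarietyCohomologyExteriorH1` (`finrank_eq`).
-/

noncomputable section

set_option linter.dupNamespace false

open CategoryTheory AlgebraicGeometry
open Literature.AlgebraicGeometry Literature.AlgebraicGeometry.Motives Literature.AlgebraicGeometry.HodgeTheory
open Literature.AlgebraicTopology.SingularHomology

namespace Summit.HodgeConjecture.HodgeConjecture.Cruxes.BlochSeedDiscOne.SeedChecker.GramValue

open Summit.HodgeConjecture.HodgeConjecture.Cruxes.BlochSeedDiscOne.Anchor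
open Summit.Ventures.HSemireg Summit.Ventures.HSemireg.Pad4Tower

/-! ## §40.1 Degree bookkeeping (private re-derivation of v39 §39.1 ∕ §39.3, whose farm snapshot is unbuilt) -/

section Interchange

variable {Y : Type} [TopologicalSpace Y]

/-- middle-four interchange `(x ∪ y) ∪ (x' ∪ y') = (−1)^{|y||x'|} (x ∪ x') ∪ (y ∪ y')`.
[cite: HatcherAT2002, §3.2 Thm. 3.11 and p. 211] -/
private theorem cup_interchange {a b a' b' n n' N A B : ℕ} (hn : a + b = n) (hn' : a' + b' = n') (hN : n + n' = N)
    (hA : a + a' = A) (hB : b + b' = B) (hAB : A + B = N) (x : singularCohomology ℂ ℂ Y a)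
    (y : singularCohomology ℂ ℂ Y b) (x' : singularCohomology ℂ ℂ Y a') (y' : singularCohomology ℂ ℂ Y b') :
    cupProduct hN (cupProduct hn x y) (cupProduct hn' x' y') =
      ((-1 : ℂ) ^ (b * a')) • cupProduct hAB (cupProduct hA x x') (cupProduct hB y y') := by
  rw [cupProduct_assoc hn (rfl : b + n' = b + n') hN (by omega) x y,
    ← cupProduct_assoc (rfl : b + a' = b + a') hn' (by omega : b + a' + b' = b + n') rfl y x' y',
    cupProduct_gradedComm_holds ℂ Y (rfl : b + a' = b + a') (Nat.add_comm a' b) y x', map_smul, LinearMap.smul_apply,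
    map_smul, cupProduct_assoc (Nat.add_comm a' b) hB (by omega : b + a' + b' = b + n') (by omega) x' y y',
    ← cupProduct_assoc hA (by omega : a' + B = b + n') hAB (by omega) x x']

/-- `(f^*x ∪ g^*y) ∪ (f^*x' ∪ g^*y') = (−1)^{|y||x'|} f^*(x ∪ x') ∪ g^*(y ∪ y')` for `ℂ`-schemes.
[cite: HatcherAT2002, §3.2 Prop. 3.10] -/
private theorem cupMap_interchange {X X₁ X₂ : SchemeOver ℂ} (f : X ⟶ X₁) (g : X ⟶ X₂)
    {a b a' b' n n' N A B : ℕ} (hn : a + b = n) (hn' : a' + b' = n') (hN : n + n' = N)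
    (hA : a + a' = A) (hB : b + b' = B) (hAB : A + B = N) (x : complexBetti X₁ a)
    (y : complexBetti X₂ b) (x' : complexBetti X₁ a') (y' : complexBetti X₂ b') :
    cupProduct hN (cupProduct hn (complexBetti.map f a x) (complexBetti.map g b y))
        (cupProduct hn' (complexBetti.map f a' x') (complexBetti.map g b' y')) =
      ((-1 : ℂ) ^ (b * a')) • cupProduct hAB (complexBetti.map f A (cupProduct hA x x'))
        (complexBetti.map g B (cupProduct hB y y')) := by
  rw [cup_interchange hn hn' hN hA hB hAB, complexBetti.map_cupProduct f hA, complexBetti.map_cupProduct g hB]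

/-- … without sign for `|y|·|x'|` even. -/
private theorem cupMap_interchange_of_even {X X₁ X₂ : SchemeOver ℂ} (f : X ⟶ X₁) (g : X ⟶ X₂)
    {a b a' b' n n' N A B : ℕ} (hn : a + b = n) (hn' : a' + b' = n') (hN : n + n' = N)
    (hA : a + a' = A) (hB : b + b' = B) (hAB : A + B = N) (he : Even (b * a')) (x : complexBetti X₁ a)
    (y : complexBetti X₂ b) (x' : complexBetti X₁ a') (y' : complexBetti X₂ b') :
    cupProduct hN (cupProduct hn (complexBetti.map f a x) (complexBetti.map g b y))
        (cupProduct hn' (complexBetti.map f a' x') (complexBetti.map g b' y')) =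
      cupProduct hAB (complexBetti.map f A (cupProduct hA x x')) (complexBetti.map g B (cupProduct hB y y')) := by
  rw [cupMap_interchange f g hn hn' hN hA hB hAB, he.neg_one_pow, one_smul]

end Interchange

theorem d1122 : 2 * 1 + 2 * 1 = 2 * 2 := rfl
theorem d2244 : 2 * 2 + 2 * 2 = 2 * 4 := rfl
theorem d3366 : 2 * 3 + 2 * 3 = 2 * 6 := rfl
theorem d4488 : 2 * 4 + 2 * 4 = 2 * 8 := rfl
theorem d4226 : 2 * 4 + 2 * 2 = 2 * 6 := rfl
theorem d6228 : 2 * 6 + 2 * 2 = 2 * 8 := rfl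

/-! ## §40.2 On the curve: the `η`-coordinate `q(v)` of `v ∪ ψ₀^*v` — it EXISTS, is RATIONAL and NON-ZERO -/

section Curve

variable {E₀ : AbelianVariety ℂ} {ψ₀ : E₀ ⟶ E₀} {η : complexBetti E₀.X (2 * 1)}

/-- `H²(E₀(ℂ); ℂ)` is a line (`b₂(E₀) = 1`): every class is a multiple of a non-zero `η`.
[cite: LangeBirkenhake1992, Exercise 1.1.6 (8)] -/
theorem exists_eq_smul_eta (hE : E₀.dim = 1) (hη0 : η ≠ 0) (x : complexBetti E₀.X (2 * 1)) : ∃ c : ℂ, x = c • η := by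
  have h2 : Module.finrank ℂ (complexBetti E₀.X (2 * 1)) = 1 := by
    have h := abelianVarietyCohomologyExteriorH1_holds.finrank_eq E₀ (2 * 1)
    rw [hE] at h
    rw [h]
    decide
  obtain ⟨c, hc⟩ := (finrank_eq_one_iff_of_nonzero' η hη0).mp h2 x
  exact ⟨c, hc.symm⟩

/-- **the `η`-coordinate of `v ∪ ψ₀^*v` is RATIONAL** for rational `v`, `η` (`η ≠ 0`): `v ∪ ψ₀^*v = q·η`, `q ∈ ℚ`
(cup products and pull-backs of rational classes are rational; a complex multiple of a non-zero rational class is rational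
only for a rational multiplier, `IsRationalClass.exists_rat_eq_of_smul`). [cite: VoisinHodgeI2002, §7.1.1]
[cite: HatcherAT2002, §3.2] -/
theorem exists_rat_cup_map_eq_smul (hE : E₀.dim = 1) (hη : IsRationalClass η) (hη0 : η ≠ 0)
    {v : complexBetti E₀.X 1} (hv : IsRationalClass v) :
    ∃ q : ℚ, cupProduct one_add_one_eq_two_mul_one v (complexBetti.map ψ₀.hom.hom.hom 1 v) = ((q : ℚ) : ℂ) • η := by
  obtain ⟨c, hc⟩ :=
    exists_eq_smul_eta hE hη0 (cupProduct one_add_one_eq_two_mul_one v (complexBetti.map ψ₀.hom.hom.hom 1 v))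
  have hrat : IsRationalClass (c • η) := hc ▸ hv.cup one_add_one_eq_two_mul_one (hv.map _)
  obtain ⟨q, rfl⟩ := IsRationalClass.exists_rat_eq_of_smul hη hη0 hrat
  exact ⟨q, hc⟩

/-- **`v ∪ ψ₀^*v ≠ 0`** for a rational `v ≠ 0` (`{v, ψ₀^*v}` is a basis of `H¹(E₀(ℂ))`, `v ∪ v = 0`, and the cup pairing of the
closed surface `E₀(ℂ)` is perfect). [cite: HatcherAT2002, §3.3 Prop. 3.38] -/
theorem cup_map_one_ne_zero (hE : E₀.dim = 1) (hψ : ψ₀ ≫ ψ₀ = -(1 • 𝟙 E₀)) {v : complexBetti E₀.X 1}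
    (hv : IsRationalClass v) (hv0 : v ≠ 0) :
    cupProduct one_add_one_eq_two_mul_one v (complexBetti.map ψ₀.hom.hom.hom 1 v) ≠ 0 := by
  set w : complexBetti E₀.X 1 := complexBetti.map ψ₀.hom.hom.hom 1 v with hw
  intro h0
  have hli : LinearIndependent ℂ ![v, w] := linearIndependent_pair_map_one one_pos hψ hv hv0
  have hspan : Submodule.span ℂ (Set.range ![v, w]) = ⊤ :=
    hli.span_eq_top_of_card_eq_finrank (by rw [Fintype.card_fin, AbelianVariety.finrank_complexBetti_one, hE])
  have hvv : cupProduct one_add_one_eq_two_mul_one v v = 0 := cup_self_deg_one v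
  refine hv0 (eq_zero_of_forall_cupPairing_eq_zero
    (fun _ _ hX ↦ Classical.choice (Motives.ComplexPoints.isOrientableOver ℂ hX)) (isSmoothProjective_of_dim_eq' hE)
    one_add_one_eq_two_mul_one fun b ↦ ?_)
  have hb : b ∈ Submodule.span ℂ (Set.range ![v, w]) := by rw [hspan]; exact Submodule.mem_top
  rw [Matrix.range_cons_cons_empty, Submodule.mem_span_pair] at hb
  obtain ⟨s, t, rfl⟩ := hb
  simp only [cupPairing_apply, map_add, map_smul, hvv, h0, smul_zero, add_zero, map_zero, LinearMap.zero_apply]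

/-- hence **`q ≠ 0`** (and `η ≠ 0`) whenever `v ∪ ψ₀^*v = q·η`, `v` rational non-zero. -/
theorem rat_ne_zero_of_cup_map_eq (hE : E₀.dim = 1) (hψ : ψ₀ ≫ ψ₀ = -(1 • 𝟙 E₀)) {v : complexBetti E₀.X 1}
    (hv : IsRationalClass v) (hv0 : v ≠ 0) {q : ℚ}
    (hq : cupProduct one_add_one_eq_two_mul_one v (complexBetti.map ψ₀.hom.hom.hom 1 v) = ((q : ℚ) : ℂ) • η) : q ≠ 0 := by
  rintro rfl
  exact cup_map_one_ne_zero hE hψ hv hv0 (by rw [hq, Rat.cast_zero, zero_smul])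

/-- `x⁺ ∪ x⁺ = 0`. -/
theorem xPlus_cup_xPlus (v : complexBetti E₀.X 1) :
    cupProduct one_add_one_eq_two_mul_one (xPlus ψ₀ v) (xPlus ψ₀ v) = 0 :=
  cup_self_deg_one (xPlus ψ₀ v)

/-- `x⁻ ∪ x⁻ = 0`. -/
theorem xMinus_cup_xMinus (v : complexBetti E₀.X 1) :
    cupProduct one_add_one_eq_two_mul_one (xMinus ψ₀ v) (xMinus ψ₀ v) = 0 :=
  cup_self_deg_one (xMinus ψ₀ v)

/-- **`x⁺ ∪ x⁻ = 2i·q·η`** when `v ∪ ψ₀^*v = q·η` (`v ∪ v = ψ₀^*v ∪ ψ₀^*v = 0`, `ψ₀^*v ∪ v = −v ∪ ψ₀^*v`).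
[cite: HatcherAT2002, §3.2 Thm. 3.11] [cite: vanGeemen1994HodgeAV, 4.9] -/
theorem xPlus_cup_xMinus {v : complexBetti E₀.X 1} {q : ℚ}
    (hq : cupProduct one_add_one_eq_two_mul_one v (complexBetti.map ψ₀.hom.hom.hom 1 v) = ((q : ℚ) : ℂ) • η) :
    cupProduct one_add_one_eq_two_mul_one (xPlus ψ₀ v) (xMinus ψ₀ v) = (2 * Complex.I * q) • η := by
  set w : complexBetti E₀.X 1 := complexBetti.map ψ₀.hom.hom.hom 1 v with hw
  have hvv : cupProduct one_add_one_eq_two_mul_one v v = 0 := cup_self_deg_one v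
  have hww : cupProduct one_add_one_eq_two_mul_one w w = 0 := cup_self_deg_one w
  have hwv : cupProduct one_add_one_eq_two_mul_one w v = -cupProduct one_add_one_eq_two_mul_one v w := by
    rw [cupProduct_gradedComm_holds ℂ (ComplexPoints E₀.X) one_add_one_eq_two_mul_one one_add_one_eq_two_mul_one w v]
    simp
  have hP : xPlus ψ₀ v = v - Complex.I • w := rfl
  have hM : xMinus ψ₀ v = v + Complex.I • w := rfl
  rw [hP, hM]
  simp only [map_sub, map_add, map_smul, LinearMap.sub_apply, LinearMap.smul_apply, hvv, hww, hwv, hq, smul_zero,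
    smul_neg]
  module

/-- **`x⁻ ∪ x⁺ = −2i·q·η`.** -/
theorem xMinus_cup_xPlus {v : complexBetti E₀.X 1} {q : ℚ}
    (hq : cupProduct one_add_one_eq_two_mul_one v (complexBetti.map ψ₀.hom.hom.hom 1 v) = ((q : ℚ) : ℂ) • η) :
    cupProduct one_add_one_eq_two_mul_one (xMinus ψ₀ v) (xPlus ψ₀ v) = (-(2 * Complex.I * q)) • η := by
  rw [cupProduct_gradedComm_holds ℂ (ComplexPoints E₀.X) one_add_one_eq_two_mul_one one_add_one_eq_two_mul_one
    (xMinus ψ₀ v) (xPlus ψ₀ v), xPlus_cup_xMinus hq, smul_smul, pow_one, neg_mul, one_mul]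

/-- **`v`-RELATIVITY of `q`**: for `v' = a·v + b·ψ₀^*v` (`a, b ∈ ℚ`) one has `v' ∪ ψ₀^*v' = (a² + b²)·q·η` — the coordinate
`q` changes by NORMS from `ℚ(i)` (`x'⁺ = (a + ib)·x⁺`, v7.1 FLAG (1)). [cite: vanGeemen1994HodgeAV, 4.9] -/
theorem cup_map_of_rat_comb (hψ : ψ₀ ≫ ψ₀ = -(1 • 𝟙 E₀)) {v : complexBetti E₀.X 1} {q : ℚ}
    (hq : cupProduct one_add_one_eq_two_mul_one v (complexBetti.map ψ₀.hom.hom.hom 1 v) = ((q : ℚ) : ℂ) • η) (a b : ℚ)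
    {v' : complexBetti E₀.X 1} (hv' : v' = ((a : ℚ) : ℂ) • v + ((b : ℚ) : ℂ) • complexBetti.map ψ₀.hom.hom.hom 1 v) :
    cupProduct one_add_one_eq_two_mul_one v' (complexBetti.map ψ₀.hom.hom.hom 1 v') = ((((a ^ 2 + b ^ 2) * q : ℚ)) : ℂ) • η := by
  subst hv'
  have hψw : complexBetti.map ψ₀.hom.hom.hom 1 (complexBetti.map ψ₀.hom.hom.hom 1 v) = -v := by
    rw [complexBetti_map_map_one_of_comp_self hψ v, Nat.cast_one, one_smul]
  have hvv : cupProduct one_add_one_eq_two_mul_one v v = 0 := cup_self_deg_one v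
  have hww : cupProduct one_add_one_eq_two_mul_one (complexBetti.map ψ₀.hom.hom.hom 1 v)
      (complexBetti.map ψ₀.hom.hom.hom 1 v) = 0 := cup_self_deg_one _
  have hwv : cupProduct one_add_one_eq_two_mul_one (complexBetti.map ψ₀.hom.hom.hom 1 v) v =
      -cupProduct one_add_one_eq_two_mul_one v (complexBetti.map ψ₀.hom.hom.hom 1 v) := by
    rw [cupProduct_gradedComm_holds ℂ (ComplexPoints E₀.X) one_add_one_eq_two_mul_one one_add_one_eq_two_mul_one
      (complexBetti.map ψ₀.hom.hom.hom 1 v) v]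
    simp
  simp only [map_add, map_smul, hψw, map_neg, LinearMap.add_apply, LinearMap.smul_apply, smul_neg, hvv, hww, hwv, hq,
    smul_zero, neg_neg, zero_add]
  push_cast
  module

/-- and EVERY rational `v'` is such a combination: `{v, ψ₀^*v}` is a `ℚ`-basis of the rational classes of `H¹(E₀(ℂ))`
(`ℂ`-independence ⟺ no rational relation, `linearIndependent_iff_of_isRationalClass`; `b₁ = 2`).
[cite: VoisinHodgeI2002, §7.1.1] [cite: LangeBirkenhake1992, §1.1] -/
theorem exists_rat_pair_eq (hE : E₀.dim = 1) (hψ : ψ₀ ≫ ψ₀ = -(1 • 𝟙 E₀)) {v : complexBetti E₀.X 1}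
    (hv : IsRationalClass v) (hv0 : v ≠ 0) {v' : complexBetti E₀.X 1} (hv' : IsRationalClass v') :
    ∃ a b : ℚ, v' = ((a : ℚ) : ℂ) • v + ((b : ℚ) : ℂ) • complexBetti.map ψ₀.hom.hom.hom 1 v := by
  classical
  haveI : Module.Finite ℂ (complexBetti E₀.X 1) := finite_complexBetti_abelianVariety E₀ 1
  set w : complexBetti E₀.X 1 := complexBetti.map ψ₀.hom.hom.hom 1 v with hw
  let b : Fin 3 → complexBetti E₀.X 1 := ![v, w, v']
  have hb : ∀ j, IsRationalClass (b j) := by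
    intro j
    fin_cases j
    · exact hv
    · exact hv.map _
    · exact hv'
  have hdep : ¬ LinearIndependent ℂ b := by
    intro hli
    have h3 := hli.fintype_card_le_finrank
    rw [Fintype.card_fin, AbelianVariety.finrank_complexBetti_one, hE] at h3
    omega
  rw [linearIndependent_iff_of_isRationalClass hb] at hdep
  push Not at hdep
  obtain ⟨c, hc, hc0⟩ := hdep
  simp only [b, Fin.sum_univ_three, Matrix.cons_val_zero, Matrix.cons_val_one, Matrix.cons_val] at hc
  have hc2 : c 2 ≠ 0 := by
    intro h2
    rw [h2, Rat.cast_zero, zero_smul, add_zero] at hc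
    have hpair := LinearIndependent.pair_iff.1 (linearIndependent_pair_map_one one_pos hψ hv hv0) _ _ hc
    apply hc0
    funext j
    fin_cases j
    · exact_mod_cast hpair.1
    · exact_mod_cast hpair.2
    · exact h2
  refine ⟨-(c 0 / c 2), -(c 1 / c 2), ?_⟩
  have hc2' : ((c 2 : ℚ) : ℂ) ≠ 0 := by exact_mod_cast hc2
  have key : v' = (-(((c 2 : ℚ) : ℂ))⁻¹) • (((c 0 : ℚ) : ℂ) • v + ((c 1 : ℚ) : ℂ) • w) := by
    have h1 : ((c 2 : ℚ) : ℂ) • v' = -(((c 0 : ℚ) : ℂ) • v + ((c 1 : ℚ) : ℂ) • w) := by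
      rw [eq_neg_iff_add_eq_zero, add_comm]; exact hc
    calc v' = (((c 2 : ℚ) : ℂ))⁻¹ • (((c 2 : ℚ) : ℂ) • v') := by rw [smul_smul, inv_mul_cancel₀ hc2', one_smul]
      _ = _ := by rw [h1, smul_neg, ← neg_smul]
  rw [key]
  push_cast
  module

end Curve

/-! ## §40.3 On the Weil surface `S`: `e ∪ e = ē ∪ ē = 0` and `e ∪ ē = ē ∪ e = −4q²·p`, `p = pr₁^*η ∪ pr₂^*η` the point word -/

section Surface

variable {E₀ : AbelianVariety ℂ} {ψ₀ : E₀ ⟶ E₀} {η : complexBetti E₀.X (2 * 1)}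

/-- **`e ∪ e = 0`** on `S = E₀ × E₀` (interchange + `x⁺ ∪ x⁺ = 0`). [cite: HatcherAT2002, §3.2 Thm. 3.16] -/
theorem eLetter_cup_eLetter (v : complexBetti E₀.X 1) : cupProduct d1122 (eLetter ψ₀ v) (eLetter ψ₀ v) = 0 := by
  rw [eLetter, cupMap_interchange _ _ one_add_one_eq_two_mul_one one_add_one_eq_two_mul_one d1122 one_add_one_eq_two_mul_one
      one_add_one_eq_two_mul_one d1122,
    xPlus_cup_xPlus, map_zero, map_zero, LinearMap.zero_apply, smul_zero]

/-- **`ē ∪ ē = 0`.** -/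
theorem ebarLetter_cup_ebarLetter (v : complexBetti E₀.X 1) :
    cupProduct d1122 (ebarLetter ψ₀ v) (ebarLetter ψ₀ v) = 0 := by
  rw [ebarLetter, cupMap_interchange _ _ one_add_one_eq_two_mul_one one_add_one_eq_two_mul_one d1122
      one_add_one_eq_two_mul_one one_add_one_eq_two_mul_one d1122,
    xMinus_cup_xMinus, map_zero, map_zero, LinearMap.zero_apply, smul_zero]

/-- the point word `p = u ∪ v = pr₁^*η ∪ pr₂^*η` of v10 §13.3, respelled in degree `2·1 + 2·1`. -/
theorem pLetter_eq : pLetter η = cupProduct d1122 (complexBetti.map (AbelianVariety.fst E₀ E₀).hom.hom.hom (2 * 1) η)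
    (complexBetti.map (AbelianVariety.snd E₀ E₀).hom.hom.hom (2 * 1) η) := rfl

/-- **`e ∪ ē = −4q²·p`** when `v ∪ ψ₀^*v = q·η`: `(pr₁^*x⁺ ∪ pr₂^*x⁻) ∪ (pr₁^*x⁻ ∪ pr₂^*x⁺) = −pr₁^*(x⁺x⁻) ∪ pr₂^*(x⁻x⁺)
= −(2iq)(−2iq)·pr₁^*η ∪ pr₂^*η`. [cite: HatcherAT2002, §3.2 Thm. 3.16 and Prop. 3.10] [cite: vanGeemen1994HodgeAV, proof of Thm. 6.12] -/
theorem eLetter_cup_ebarLetter {v : complexBetti E₀.X 1} {q : ℚ}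
    (hq : cupProduct one_add_one_eq_two_mul_one v (complexBetti.map ψ₀.hom.hom.hom 1 v) = ((q : ℚ) : ℂ) • η) :
    cupProduct d1122 (eLetter ψ₀ v) (ebarLetter ψ₀ v) = (-(4 : ℂ) * (q : ℂ) ^ 2) • pLetter η := by
  rw [eLetter, ebarLetter, cupMap_interchange _ _ one_add_one_eq_two_mul_one one_add_one_eq_two_mul_one d1122
      one_add_one_eq_two_mul_one one_add_one_eq_two_mul_one d1122,
    xPlus_cup_xMinus hq, xMinus_cup_xPlus hq, pLetter_eq]
  simp only [map_smul, LinearMap.smul_apply, smul_smul]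
  congr 1
  have hI : Complex.I * Complex.I = -1 := Complex.I_mul_I
  linear_combination (4 * (q : ℂ) ^ 2) * hI

/-- **`ē ∪ e = −4q²·p`** as well (even degrees commute). [cite: HatcherAT2002, §3.2 Thm. 3.11] -/
theorem ebarLetter_cup_eLetter {v : complexBetti E₀.X 1} {q : ℚ}
    (hq : cupProduct one_add_one_eq_two_mul_one v (complexBetti.map ψ₀.hom.hom.hom 1 v) = ((q : ℚ) : ℂ) • η) :
    cupProduct d1122 (ebarLetter ψ₀ v) (eLetter ψ₀ v) = (-(4 : ℂ) * (q : ℂ) ^ 2) • pLetter η := by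
  rw [cupProduct_gradedComm_holds ℂ (ComplexPoints (weilSurf E₀).X) d1122 d1122 (ebarLetter ψ₀ v) (eLetter ψ₀ v),
    eLetter_cup_ebarLetter hq]
  norm_num

/-- `p ≠ 0` for `η ≠ 0` (Künneth injectivity on `E₀ × E₀`). [cite: HatcherAT2002, §3.2 Thm. 3.16] -/
theorem pLetter_ne_zero (hE : E₀.dim = 1) (hη0 : η ≠ 0) : pLetter η ≠ 0 := by
  rw [pLetter_eq]
  exact cupProduct_map_fst_map_snd_ne_zero_of_add_eq (isSmoothProjective_of_dim_eq' hE) (isSmoothProjective_of_dim_eq' hE)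
    d1122 (by omega) hη0 hη0

end Surface

/-! ## §40.4 Up the tower: `pstep b x = pr₁^*b ∪ pr₂^*x` for a surface POINT class `x`, `ppppOf x = x ⊠ x ⊠ x ⊠ x`,
and `eeee ∪ ēēēē = (e ∪ ē) ⊠ (e ∪ ē) ⊠ (e ∪ ē) ⊠ (e ∪ ē) = 256·q⁸ · p ⊠ p ⊠ p ⊠ p` -/

section Tower

variable {E₀ : AbelianVariety ℂ} {B : AbelianVariety ℂ} {ψ₀ : E₀ ⟶ E₀} {η : complexBetti E₀.X (2 * 1)}

/-- **one step `b ⊠ x = pr₁^*b ∪ pr₂^*x ∈ H^{2(n+2)}((B × S)(ℂ))`** of the nested tower for a degree-FOUR surface class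
`x ∈ H⁴(S(ℂ))` (the point-word analogue of v7.1 `cross` ∕ v10 `xstep`, which take a degree-two letter).
[cite: HatcherAT2002, §3.2 Thm. 3.16] -/
def pstep {n : ℕ} (b : complexBetti B.X (2 * n)) (x : complexBetti (weilSurf E₀).X (2 * 2)) :
    complexBetti (B.prod (weilSurf E₀)).X (2 * (n + 2)) :=
  cupProduct (two_mul_add_two_mul n 2)
    (complexBetti.map (AbelianVariety.fst B (weilSurf E₀)).hom.hom.hom (2 * n) b)
    (complexBetti.map (AbelianVariety.snd B (weilSurf E₀)).hom.hom.hom (2 * 2) x)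

/-- `pstep` is bilinear: `(r·b) ⊠ (s·x) = (r s)·(b ⊠ x)`. -/
theorem pstep_smul {n : ℕ} (r s : ℂ) (b : complexBetti B.X (2 * n)) (x : complexBetti (weilSurf E₀).X (2 * 2)) :
    pstep (r • b) (s • x) = (r * s) • pstep b x := by
  simp only [pstep, map_smul, LinearMap.smul_apply, smul_smul, mul_comm]

/-- `b ⊠ x ≠ 0` for `b, x ≠ 0` (Künneth injectivity). [cite: HatcherAT2002, §3.2 Thm. 3.16] -/
theorem pstep_ne_zero {m n : ℕ} (hB : B.dim = m) (hE : E₀.dim = 1) {b : complexBetti B.X (2 * n)}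
    {x : complexBetti (weilSurf E₀).X (2 * 2)} (hb : b ≠ 0) (hx : x ≠ 0) : pstep b x ≠ 0 :=
  cupProduct_map_fst_map_snd_ne_zero_of_add_eq (isSmoothProjective_of_dim_eq' hB)
    (isSmoothProjective_of_dim_eq' (weilSurf_dim hE)) (two_mul_add_two_mul n 2) (by omega) hb hx

/-- **`x ⊠ x ⊠ x ⊠ x ∈ H¹⁶(S⁴(ℂ); ℂ)`** nested EXACTLY as `pad4Anchor E₀ = ((S × S) × S) × S`. -/
def ppppOf (x : complexBetti (weilSurf E₀).X (2 * 2)) : complexBetti (pad4Anchor E₀).X (2 * 8) :=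
  pstep (pstep (pstep x x) x) x

/-- `(s·x)^{⊠4} = s⁴ · x^{⊠4}`. -/
theorem ppppOf_smul (s : ℂ) (x : complexBetti (weilSurf E₀).X (2 * 2)) : ppppOf (s • x) = s ^ 4 • ppppOf x := by
  rw [show s ^ 4 = s * s * s * s by ring]
  simp only [ppppOf, pstep_smul]

/-- `x^{⊠4} ≠ 0` for `x ≠ 0`. -/
theorem ppppOf_ne_zero (hE : E₀.dim = 1) {x : complexBetti (weilSurf E₀).X (2 * 2)} (hx : x ≠ 0) : ppppOf x ≠ 0 :=
  pstep_ne_zero (dim_prod_eq_two_mul (dim_prod_eq_two_mul (weilSurf_dim hE) (weilSurf_dim hE)) (weilSurf_dim hE)) hE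
    (pstep_ne_zero (dim_prod_eq_two_mul (weilSurf_dim hE) (weilSurf_dim hE)) hE
      (pstep_ne_zero (weilSurf_dim hE) hE hx hx) hx) hx

/-- **the Künneth-square ∕ interchange lemma for v7.1's `cross`**: `cross b c ∪ cross b' c' = pr₁^*(b ∪ b') ∪ pr₂^*(c ∪ c')`
(all degrees even, no sign; = v39 `cross_cup_cross`, re-derived privately). [cite: HatcherAT2002, §3.2 Thm. 3.16 and Prop. 3.10] -/
private theorem cross_cup_cross {n n' N M : ℕ} (hN : 2 * (n + 1) + 2 * (n' + 1) = N) (hM : 2 * n + 2 * n' = M)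
    (hMN : M + 2 * 2 = N) (b : complexBetti B.X (2 * n)) (b' : complexBetti B.X (2 * n'))
    (c c' : complexBetti (weilSurf E₀).X (2 * 1)) :
    cupProduct hN (cross b c) (cross b' c') =
      cupProduct hMN (complexBetti.map (AbelianVariety.fst B (weilSurf E₀)).hom.hom.hom M (cupProduct hM b b'))
        (complexBetti.map (AbelianVariety.snd B (weilSurf E₀)).hom.hom.hom (2 * 2) (cupProduct d1122 c c')) :=
  cupMap_interchange_of_even _ _ (two_mul_add_two_mul n 1) (two_mul_add_two_mul n' 1) hN hM d1122 hMN
    ((even_two_mul 1).mul_right (2 * n')) b c b' c'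

variable (ψ₀)

/-- **`eeee ∪ ēēēē = (e ∪ ē)^{⊠4}`** — three Künneth squares up the nested tower. [cite: HatcherAT2002, §3.2 Thm. 3.16] -/
theorem eeee_cup_eeeeBar_eq_ppppOf (h : 2 * 4 + 2 * 4 = 2 * 8) (v : complexBetti E₀.X 1) :
    cupProduct h (eeee ψ₀ v) (eeeeBar ψ₀ v) = ppppOf (cupProduct d1122 (eLetter ψ₀ v) (ebarLetter ψ₀ v)) := by
  rw [eeee, eeeeBar, cross_cup_cross h d3366 d6228, eThree, ebarThree, cross_cup_cross d3366 d2244 d4226, eTwo, ebarTwo,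
    cross_cup_cross d2244 d1122 d2244]
  rfl

/-- `eeee ∪ eeee = 0` (`e ∪ e = 0` pushed up the tower). -/
theorem eeee_cup_eeee (h : 2 * 4 + 2 * 4 = 2 * 8) (v : complexBetti E₀.X 1) : cupProduct h (eeee ψ₀ v) (eeee ψ₀ v) = 0 := by
  rw [eeee, cross_cup_cross h d3366 d6228, eThree, cross_cup_cross d3366 d2244 d4226, eTwo, cross_cup_cross d2244 d1122 d2244,
    eLetter_cup_eLetter]
  simp only [map_zero]

/-- `ēēēē ∪ ēēēē = 0`. -/
theorem eeeeBar_cup_eeeeBar (h : 2 * 4 + 2 * 4 = 2 * 8) (v : complexBetti E₀.X 1) :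
    cupProduct h (eeeeBar ψ₀ v) (eeeeBar ψ₀ v) = 0 := by
  rw [eeeeBar, cross_cup_cross h d3366 d6228, ebarThree, cross_cup_cross d3366 d2244 d4226, ebarTwo,
    cross_cup_cross d2244 d1122 d2244, ebarLetter_cup_ebarLetter]
  simp only [map_zero]

/-- `ēēēē ∪ eeee = eeee ∪ ēēēē` (degrees `8·8` even). [cite: HatcherAT2002, §3.2 Thm. 3.11] -/
theorem eeeeBar_cup_eeee (h : 2 * 4 + 2 * 4 = 2 * 8) (v : complexBetti E₀.X 1) :
    cupProduct h (eeeeBar ψ₀ v) (eeee ψ₀ v) = cupProduct h (eeee ψ₀ v) (eeeeBar ψ₀ v) := by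
  rw [cupProduct_gradedComm_holds ℂ (ComplexPoints (pad4Anchor E₀).X) h h (eeeeBar ψ₀ v) (eeee ψ₀ v),
    Even.neg_one_pow (by decide), one_smul]

variable {ψ₀}

/-- **THE VALUE OF THE TOP CLASS OF THE FRAME OF RECORD: `eeee ∪ ēēēē = 256·q⁸ · p^{⊠4}`** (`(−4q²)⁴ = 256q⁸`). -/
theorem eeee_cup_eeeeBar_eq (h : 2 * 4 + 2 * 4 = 2 * 8) {v : complexBetti E₀.X 1} {q : ℚ}
    (hq : cupProduct one_add_one_eq_two_mul_one v (complexBetti.map ψ₀.hom.hom.hom 1 v) = ((q : ℚ) : ℂ) • η) :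
    cupProduct h (eeee ψ₀ v) (eeeeBar ψ₀ v) = ((256 : ℂ) * (q : ℂ) ^ 8) • ppppOf (pLetter η) := by
  rw [eeee_cup_eeeeBar_eq_ppppOf, eLetter_cup_ebarLetter hq, ppppOf_smul]
  congr 1
  ring

end Tower

/-! ## §40.5 The frame polarisation: `h_std⁸ = 8! · p^{⊠4}` (the only e-free word of degree `8` is `pppp`; law (F1) of v10) -/

section HStd

variable {E₀ : AbelianVariety ℂ} (η : complexBetti E₀.X (2 * 1)) (e ebar : complexBetti (weilSurf E₀).X (2 * 1))

/-- the word `pppp` (pad4lib letter `p = 5` on every factor). -/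
def ppppWord : CWord := fun _ => 5

theorem wdeg_ppppWord : wdeg ppppWord = 8 := rfl

theorem eFree_ppppWord : EFree ppppWord := fun _ => ⟨(by decide : (5 : Fin 6) ≠ 3), (by decide : (5 : Fin 6) ≠ 4)⟩

/-- **`pppp` is THE word of degree `8`** (every letter has `ldeg ≤ 2`, with equality only for `p`). -/
theorem eq_ppppWord_of_wdeg_eq {w : CWord} (hw : wdeg w = 8) : w = ppppWord := by
  have h5 : ∀ l : Fin 6, ldeg l = 2 → l = 5 := by decide
  have h0 := ldeg_le_two (w 0)
  have h1 := ldeg_le_two (w 1)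
  have h2 := ldeg_le_two (w 2)
  have h3 := ldeg_le_two (w 3)
  unfold wdeg at hw
  have e0 : ldeg (w 0) = 2 := by omega
  have e1 : ldeg (w 1) = 2 := by omega
  have e2 : ldeg (w 2) = 2 := by omega
  have e3 : ldeg (w 3) = 2 := by omega
  funext i
  fin_cases i
  exacts [h5 _ e0, h5 _ e1, h5 _ e2, h5 _ e3]

/-- `cls(pp)_4 = p ⊠ p` on `S²`. -/
theorem frameCls2_pp : frameCls2 η e ebar (Fin.init (Fin.init ppppWord)) 4 = pstep (pLetter η) (pLetter η) :=
  (famCross_single (fun _ hi => letterFam_eq_zero η e ebar 5 hi) ⟨2, by omega⟩ rfl).trans rfl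

/-- `cls(ppp)_6 = p ⊠ p ⊠ p` on `S³`. -/
theorem frameCls3_ppp : frameCls3 η e ebar (Fin.init ppppWord) 6 = pstep (pstep (pLetter η) (pLetter η)) (pLetter η) := by
  rw [show frameCls3 η e ebar (Fin.init ppppWord) 6 = pstep (frameCls2 η e ebar (Fin.init (Fin.init ppppWord)) 4) (pLetter η)
    from (famCross_single (fun _ hi => frameCls2_eq_zero η e ebar _ hi) ⟨4, by omega⟩ rfl).trans rfl, frameCls2_pp]

/-- **`cls(pppp)_8 = p ⊠ p ⊠ p ⊠ p = p^{⊠4}`** on `S⁴`. -/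
theorem frameCls4_ppppWord : frameCls4 η e ebar ppppWord 8 = ppppOf (pLetter η) := by
  rw [show frameCls4 η e ebar ppppWord 8 = pstep (frameCls3 η e ebar (Fin.init ppppWord) 6) (pLetter η) from
    (famCross_single (fun _ hi => frameCls3_eq_zero η e ebar _ hi) ⟨6, by omega⟩ rfl).trans rfl, frameCls3_ppp]
  rfl

variable {η}

/-- **`h_std^[8] = p^{⊠4}`**: the top divided power of the frame polarisation `h_std = Σ_f (u_f + v_f)` is the class of the
point word — law (F1) of v10 (`frameCls4_law`: `Σ_{w e-free} cls(w)_8 = h_std^[8]`) with `pppp` the only word of degree `8`.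
[cite: HatcherAT2002, §3.2 Künneth formula, Thm. 3.15 online ed. (3.16 in print)] -/
theorem divPow_hStd_eight (hE : E₀.dim = 1) : divPow (pad4Anchor E₀).X (hStd E₀ η) 8 = ppppOf (pLetter η) := by
  rw [← frameCls4_law η 0 0 hE 8, Finset.sum_eq_single ppppWord]
  · exact frameCls4_ppppWord η 0 0
  · intro w _ hw
    exact frameCls4_eq_zero η 0 0 w (fun h8 => hw (eq_ppppWord_of_wdeg_eq h8.symm))
  · intro h
    exact absurd (Finset.mem_filter.2 ⟨Finset.mem_univ _, eFree_ppppWord⟩) h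

/-- **`h_std⁸ = 8! · p^{⊠4} = 40320 · p^{⊠4}`.** -/
theorem cupPowTwo_hStd_eight (hE : E₀.dim = 1) : cupPowTwo (hStd E₀ η) 8 = (40320 : ℂ) • ppppOf (pLetter η) := by
  have h := divPow_hStd_eight (η := η) hE
  have hf : ((Nat.factorial 8 : ℕ) : ℂ) = 40320 := by norm_num [Nat.factorial]
  rw [divPow, hf] at h
  rw [← h, smul_smul, mul_inv_cancel₀ (by norm_num : (40320 : ℂ) ≠ 0), one_smul]

/-- **`h_std⁸ ≠ 0`** for `η ≠ 0` — PURELY TOPOLOGICALLY (Künneth), no polarisation ∕ Kähler input (v8 ∕ v12 took it from ampleness). -/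
theorem cupPowTwo_hStd_eight_ne_zero (hE : E₀.dim = 1) (hη0 : η ≠ 0) : cupPowTwo (hStd E₀ η) 8 ≠ 0 := by
  rw [cupPowTwo_hStd_eight hE]
  exact smul_ne_zero (by norm_num) (ppppOf_ne_zero hE (pLetter_ne_zero hE hη0))

end HStd

/-! ## §40.6 The Gram constant of the frame of record: `γ(v, h_std) = 512·q⁸`, `γ(v, h_K) = 2·(q∕t)⁸`; MEMO-06's `γ = 2` -/

section Gram

open NewtonClosure

variable {E₀ : AbelianVariety ℂ} {ψ₀ : E₀ ⟶ E₀} {η : complexBetti E₀.X (2 * 1)}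
variable (hE : E₀.dim = 1) (hψ : ψ₀ ≫ ψ₀ = -(1 • 𝟙 E₀)) {v : complexBetti E₀.X 1} (hv : IsRationalClass v) (hv0 : v ≠ 0)

/-- **`2·8!·(eeee ∪ ēēēē) = 512·q⁸ · h_std⁸`** — the top class of the frame of record against the frame polarisation, as
ONE RATIONAL NUMBER. -/
theorem smul_eeee_cup_eeeeBar_eq_smul_hStd_pow (hE : E₀.dim = 1) (h : 2 * 4 + 2 * 4 = 2 * 8) {q : ℚ}
    (hq : cupProduct one_add_one_eq_two_mul_one v (complexBetti.map ψ₀.hom.hom.hom 1 v) = ((q : ℚ) : ℂ) • η) :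
    (80640 : ℂ) • cupProduct h (eeee ψ₀ v) (eeeeBar ψ₀ v) = (((512 * q ^ 8 : ℚ)) : ℂ) • cupPowTwo (hStd E₀ η) 8 := by
  rw [eeee_cup_eeeeBar_eq h hq, cupPowTwo_hStd_eight hE, smul_smul, smul_smul]
  congr 1
  push_cast
  ring

/-- bilinear expansion on the `{eeee, ēēēē}` plane: `(a·eeee + b·ēēēē) ∪ (c·eeee + d·ēēēē) = (ad + bc)·(eeee ∪ ēēēē)`. -/
theorem cup_planeComb (h : 2 * 4 + 2 * 4 = 2 * 8) (a b c d : ℂ) (v : complexBetti E₀.X 1) :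
    cupProduct h (a • eeee ψ₀ v + b • eeeeBar ψ₀ v) (c • eeee ψ₀ v + d • eeeeBar ψ₀ v) =
      (a * d + b * c) • cupProduct h (eeee ψ₀ v) (eeeeBar ψ₀ v) := by
  simp only [map_add, map_smul, LinearMap.add_apply, LinearMap.smul_apply, eeee_cup_eeee, eeeeBar_cup_eeeeBar,
    eeeeBar_cup_eeee, smul_zero, zero_add, add_zero]
  module

/-- `μ·μ̄ = N(μ)` in `ℂ`. -/
theorem toComplex_mul_toComplex_star (μ : GaussianInt) :
    GaussianInt.toComplex μ * GaussianInt.toComplex (star μ) = ((μ.norm : ℤ) : ℂ) := by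
  rw [GaussianInt.toComplex_star, Complex.mul_conj, GaussianInt.intCast_complex_norm]

/-- **`w_μ ∪ w_μ = 2·N(μ)·(eeee ∪ ēēēē)`** for the frame of record. -/
theorem wOf_cup_self (h : 2 * 4 + 2 * 4 = 2 * 8) (μ : GaussianInt) :
    cupProduct h ((normalisedFrame hE hψ hv hv0).wOf μ) ((normalisedFrame hE hψ hv hv0).wOf μ) =
      ((2 * μ.norm : ℤ) : ℂ) • cupProduct h (eeee ψ₀ v) (eeeeBar ψ₀ v) := by
  rw [normalisedFrame_wOf, cup_planeComb, mul_comm (GaussianInt.toComplex (star μ)), toComplex_mul_toComplex_star]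
  congr 1
  push_cast
  ring

/-- **v23's `FrameGram` for the frame of record is ONE top-degree identity `2·8!·(eeee ∪ ēēēē) = γ·h⁸`** (= v39
`frameGram_normalisedFrame_iff`, whose `omega` is `eeee ∪ ēēēē` by `rfl`; re-derived because v39 is not built on the farm). -/
theorem frameGram_iff_top_identity (h₂ : complexBetti (pad4Anchor E₀).X 2) (γ : ℚ) :
    FrameGram (normalisedFrame hE hψ hv hv0) h₂ γ ↔
      (80640 : ℂ) • cupProduct d4488 (eeee ψ₀ v) (eeeeBar ψ₀ v) = ((γ : ℚ) : ℂ) • cupPowTwo h₂ 8 := by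
  constructor
  · intro hG
    have h1 := hG 1
    rw [wOf_cup_self, Zsqrtd.norm_one, smul_smul] at h1
    norm_num at h1
    exact h1
  · intro hω μ
    rw [wOf_cup_self, smul_smul]
    push_cast
    rw [show (40320 : ℂ) * (2 * (μ.norm : ℂ)) = (μ.norm : ℂ) * 80640 by ring, ← smul_smul, hω, smul_smul, mul_comm]

/-- **THE GRAM CONSTANT OF THE FRAME OF RECORD AGAINST `h_std` IS `γ = 512·q⁸`** (`q` the `η`-coordinate of `v ∪ ψ₀^*v`):
rational, positive, an EIGHTH POWER up to `512 = 2⁹`; in particular never MEMO-06's `2` unless `|q| = 1∕2`. -/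
theorem frameGram_normalisedFrame_hStd_iff (hη0 : η ≠ 0) {q : ℚ}
    (hq : cupProduct one_add_one_eq_two_mul_one v (complexBetti.map ψ₀.hom.hom.hom 1 v) = ((q : ℚ) : ℂ) • η) (γ : ℚ) :
    FrameGram (normalisedFrame hE hψ hv hv0) (hStd E₀ η) γ ↔ γ = 512 * q ^ 8 := by
  rw [frameGram_iff_top_identity, smul_eeee_cup_eeeeBar_eq_smul_hStd_pow hE d4488 hq,
    (smul_left_injective ℂ (cupPowTwo_hStd_eight_ne_zero hE hη0)).eq_iff, Rat.cast_inj, eq_comm]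

/-- so the frame of record HAS the Gram constant `512·q⁸` against `h_std` … -/
theorem frameGram_normalisedFrame_hStd (hη0 : η ≠ 0) {q : ℚ}
    (hq : cupProduct one_add_one_eq_two_mul_one v (complexBetti.map ψ₀.hom.hom.hom 1 v) = ((q : ℚ) : ℂ) • η) :
    FrameGram (normalisedFrame hE hψ hv hv0) (hStd E₀ η) (512 * q ^ 8) :=
  (frameGram_normalisedFrame_hStd_iff hE hψ hv hv0 hη0 hq _).2 rfl

include hE hψ hv hv0 in
/-- … which is a POSITIVE rational. -/
theorem frameGram_value_pos {q : ℚ}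
    (hq : cupProduct one_add_one_eq_two_mul_one v (complexBetti.map ψ₀.hom.hom.hom 1 v) = ((q : ℚ) : ℂ) • η) :
    0 < (512 : ℚ) * q ^ 8 :=
  mul_pos (by norm_num) (Even.pow_pos (by decide) (rat_ne_zero_of_cup_map_eq hE hψ hv hv0 hq))

/-- MEMO-06's value against `h_std`: **`FrameGram … h_std 2 ⟺ |q| = 1∕2`.** -/
theorem frameGram_normalisedFrame_hStd_two_iff (hη0 : η ≠ 0) {q : ℚ}
    (hq : cupProduct one_add_one_eq_two_mul_one v (complexBetti.map ψ₀.hom.hom.hom 1 v) = ((q : ℚ) : ℂ) • η) :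
    FrameGram (normalisedFrame hE hψ hv hv0) (hStd E₀ η) 2 ↔ |q| = 1 / 2 := by
  rw [frameGram_normalisedFrame_hStd_iff hE hψ hv hv0 hη0 hq,
    ← pow_left_inj₀ (abs_nonneg q) (by norm_num : (0 : ℚ) ≤ 1 / 2) (by norm_num : (8 : ℕ) ≠ 0),
    Even.pow_abs (by decide : Even 8)]
  constructor
  · intro h
    linarith
  · intro h
    rw [h]
    norm_num

/-- `(c·x)ⁱ = cⁱ·xⁱ`. [cite: HatcherAT2002, §3.2] -/
private theorem cupPowTwo_smul' {Y : Type} [TopologicalSpace Y] (c : ℂ) (x : singularCohomology ℂ ℂ Y 2) (i : ℕ) :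
    cupPowTwo (c • x) i = c ^ i • cupPowTwo x i := by
  induction i with
  | zero => rw [cupPowTwo_zero, cupPowTwo_zero, pow_zero, one_smul]
  | succ i ih =>
    rw [cupPowTwo_succ, cupPowTwo_succ, ih]
    simp only [map_smul, LinearMap.smul_apply, smul_smul, pow_succ, mul_comm]

/-- **`FrameGram` under RESCALING of `h`: `FrameGram F (c·h) γ ⟺ FrameGram F h (γ·c⁸)`** (`(c·h)⁸ = c⁸·h⁸`). -/
theorem frameGram_smul_iff (F : WeilFrame E₀ ψ₀) (h₂ : complexBetti (pad4Anchor E₀).X 2) (c γ : ℚ) :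
    FrameGram F (((c : ℚ) : ℂ) • h₂) γ ↔ FrameGram F h₂ (γ * c ^ 8) := by
  unfold FrameGram
  refine forall_congr' fun μ => ?_
  rw [cupPowTwo_smul', smul_smul,
    show (((γ * (μ.norm : ℚ) : ℚ)) : ℂ) * ((c : ℚ) : ℂ) ^ 8 = (((γ * c ^ 8 * (μ.norm : ℚ) : ℚ)) : ℂ) by push_cast; ring]

/-- **THE GRAM CONSTANT AGAINST THE KIT POLARISATION `h_K = symH = 2t·h_std`: `γ_K = 2·(q∕t)⁸`** (`q` the `K.η`-coordinate of
`v ∪ ψ₀^*v`, `t = K.pol.t` the polarisation scale `e^*a = t·h_std`). -/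
theorem frameGram_normalisedFrame_symH_iff (K : AnchorKit E₀ ψ₀) {q : ℚ}
    (hq : cupProduct one_add_one_eq_two_mul_one v (complexBetti.map ψ₀.hom.hom.hom 1 v) = ((q : ℚ) : ℂ) • K.η) (γ : ℚ) :
    FrameGram (normalisedFrame hE hψ hv hv0) (symH (pad4Action E₀ ψ₀) K.pol.e K.pol.a) γ ↔ γ = 2 * (q / K.pol.t) ^ 8 := by
  rw [K.symH_eq hE hψ, frameGram_smul_iff, frameGram_normalisedFrame_hStd_iff hE hψ hv hv0 K.η_ne_zero hq, div_pow,
    mul_div_assoc', eq_div_iff (pow_ne_zero 8 K.pol.t_pos.ne')]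
  constructor
  · intro h
    linear_combination h / 256
  · intro h
    linear_combination 256 * h

/-- **MEMO-06's `γ = 2` (for `h_K`) IS THE NORMALISATION `|q| = t`**: `FrameGram (frame of record) h_K 2 ⟺ |q(v)| = K.pol.t` —
a condition TYING the generator `v` of `H¹` to the polarisation scale, decidable on the kit's two rationals. -/
theorem frameGram_normalisedFrame_symH_two_iff (K : AnchorKit E₀ ψ₀) {q : ℚ}
    (hq : cupProduct one_add_one_eq_two_mul_one v (complexBetti.map ψ₀.hom.hom.hom 1 v) = ((q : ℚ) : ℂ) • K.η) :
    FrameGram (normalisedFrame hE hψ hv hv0) (symH (pad4Action E₀ ψ₀) K.pol.e K.pol.a) 2 ↔ |q| = K.pol.t := by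
  rw [K.symH_eq hE hψ, frameGram_smul_iff, frameGram_normalisedFrame_hStd_iff hE hψ hv hv0 K.η_ne_zero hq,
    ← pow_left_inj₀ (abs_nonneg q) K.pol.t_pos.le (by norm_num : (8 : ℕ) ≠ 0), Even.pow_abs (by decide : Even 8)]
  constructor
  · intro h
    linear_combination -h / 512
  · intro h
    linear_combination -512 * h

/-- **`v`-RELATIVITY OF THE GRAM CONSTANT, EXPLICIT**: `v' = a·v + b·ψ₀^*v ⟹ γ(v', h_std) = 512·((a² + b²)·q)⁸ = (a² + b²)⁸·γ(v, h_std)`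
(v39's `γ' = r⁸γ` with `r = a² + b² = |a + ib|²`). -/
theorem frameGram_normalisedFrame_hStd_rat_comb (hη0 : η ≠ 0) {q : ℚ}
    (hq : cupProduct one_add_one_eq_two_mul_one v (complexBetti.map ψ₀.hom.hom.hom 1 v) = ((q : ℚ) : ℂ) • η) (a b : ℚ)
    {v' : complexBetti E₀.X 1} (hv'e : v' = ((a : ℚ) : ℂ) • v + ((b : ℚ) : ℂ) • complexBetti.map ψ₀.hom.hom.hom 1 v)
    (hv' : IsRationalClass v') (hv0' : v' ≠ 0) (γ : ℚ) :
    FrameGram (normalisedFrame hE hψ hv' hv0') (hStd E₀ η) γ ↔ γ = (a ^ 2 + b ^ 2) ^ 8 * (512 * q ^ 8) := by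
  rw [frameGram_normalisedFrame_hStd_iff hE hψ hv' hv0' hη0 (cup_map_of_rat_comb hψ hq a b hv'e), mul_pow]
  constructor <;> intro h <;> linear_combination h

/-- **WHEN CAN MEMO-06's `γ = 2` BE MET AT ALL?** Fix the kit `K` and ONE rational generator `v` of `H¹` (coordinate `q`):
the rational non-zero `v'` whose frame of record has `γ_K(v') = 2` are exactly the `a·v + b·ψ₀^*v` with `(a² + b²)·|q| = t` —
so `γ = 2` is ATTAINABLE iff `t ∕ |q|` is a norm from `ℚ(i)^×` (a sum of two rational squares; e.g. never for `t ∕ |q| = 3`):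
MEMO-06's normalisation is a genuine arithmetic condition on the kit, not a free choice. [cite: vanGeemen1994HodgeAV, 4.9] -/
theorem exists_frameGram_symH_two_iff (hv : IsRationalClass v) (hv0 : v ≠ 0) (K : AnchorKit E₀ ψ₀) {q : ℚ}
    (hq : cupProduct one_add_one_eq_two_mul_one v (complexBetti.map ψ₀.hom.hom.hom 1 v) = ((q : ℚ) : ℂ) • K.η) :
    (∃ (v' : complexBetti E₀.X 1) (hv' : IsRationalClass v') (hv0' : v' ≠ 0),
        FrameGram (normalisedFrame hE hψ hv' hv0') (symH (pad4Action E₀ ψ₀) K.pol.e K.pol.a) 2) ↔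
      ∃ a b : ℚ, (a ^ 2 + b ^ 2) * |q| = K.pol.t := by
  constructor
  · rintro ⟨v', hv', hv0', hG⟩
    obtain ⟨a, b, hab⟩ := exists_rat_pair_eq hE hψ hv hv0 hv'
    refine ⟨a, b, ?_⟩
    have h := (frameGram_normalisedFrame_symH_two_iff hE hψ hv' hv0' K (cup_map_of_rat_comb hψ hq a b hab)).1 hG
    rwa [abs_mul, abs_of_nonneg (by positivity)] at h
  · rintro ⟨a, b, hab⟩
    have hab0 : ¬ (a = 0 ∧ b = 0) := by
      rintro ⟨rfl, rfl⟩
      norm_num at hab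
      linarith [K.pol.t_pos]
    have hv' : IsRationalClass (((a : ℚ) : ℂ) • v + ((b : ℚ) : ℂ) • complexBetti.map ψ₀.hom.hom.hom 1 v) :=
      (hv.smul a).add ((hv.map _).smul b)
    have hv0' : ((a : ℚ) : ℂ) • v + ((b : ℚ) : ℂ) • complexBetti.map ψ₀.hom.hom.hom 1 v ≠ 0 := by
      intro h0
      have hpair := LinearIndependent.pair_iff.1 (linearIndependent_pair_map_one one_pos hψ hv hv0) _ _ h0
      exact hab0 ⟨by exact_mod_cast hpair.1, by exact_mod_cast hpair.2⟩
    refine ⟨_, hv', hv0',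
      (frameGram_normalisedFrame_symH_two_iff hE hψ hv' hv0' K (cup_map_of_rat_comb hψ hq a b rfl)).2 ?_⟩
    rwa [abs_mul, abs_of_nonneg (by positivity)]

end Gram

end Summit.HodgeConjecture.HodgeConjecture.Cruxes.BlochSeedDiscOne.SeedChecker.GramValue

end
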